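import Mathlib
import Summits.ValiantsHypothesis.ValiantsHypothesis.Theorems.GrenetZeonTwoDimCoefficientsScalingCodimLtPerGenericity

/-!
# Crux `GrenetZeon.TwoDimCoefficients` (stmt-ValiantsHypothesis-8062) / rung `DualUnipotentThreeHalves` (stmt-24318):
# scaling-closure — the KÖNIG bound: `rank Hess per_n ≤ 2n` on the subspace `{row r = 0}` (sharpness of PG(k < n))

The sharpness half of ✓ PG(k < n) (`exists_mem_fullRank_hess0_perPoly_of_codim_lt`, p837946): on the König subspace `{row r = 0}`
(codimension `n`) EVERY point has `rank Hess per_n ≤ 2n`, because a second partial `∂_{ab}∂_{cd} per_n` is an `(n−2)`-sub-permanent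
containing the zero row unless `a = r` or `c = r`.  So «codimension `< n`» in PG cannot be improved, and — the reason this file exists —
every unipotent dual representation PADDED with the König garbage `⊕_j x_{r j}·J_{n+1}` (memo NINETEENTH-HAND.md §9) forces all
index-reducing substitutions into `{row r = 0}`, where the Hessian route has nothing to work with: universal index-cost hypotheses of
T4 type are refuted on paper by this bound.

* `hess0_transl_perPoly_apply_eq_zero_of_row_zero` — the vanishing pattern;
* ★★ `rank_hess0_transl_perPoly_le_of_row_zero` — `rank Hess per_n (z) ≤ 2n` whenever a row of `z` vanishes.

HONEST FRAMING: an unconditional, route-independent fact about the permanent; it proves no rung: the stub `DualUnipotentBound`,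
crux 8062, the 24318 decl and `VP ≠ VNP` remain open.

References: T. Mignon, N. Ressayre, Int. Math. Res. Not. 2004:79, §3 (via the tree); D. Kőnig (zero rows kill the permanent);
folklore.
-/

-- single-conjunct layout `Summits/ValiantsHypothesis/ValiantsHypothesis`: the duplicated namespace
-- component is mandated by the tree.
set_option linter.dupNamespace false
set_option autoImplicit false

noncomputable section

namespace Summit.ValiantsHypothesis.ValiantsHypothesis.Theorems.GrenetZeonTwoDimCoefficients.ScalingClosure

open MvPolynomial Matrix
open Literature.Computability.AlgebraicComplexity

section Koenig

variable {n : ℕ}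

/-- On `{row r = 0}` the Hessian entry `((c,d),(a,b))` of `per_n` vanishes unless `a = r` or `c = r` (the sub-permanent keeps the
zero row). [folklore] -/
theorem hess0_transl_perPoly_apply_eq_zero_of_row_zero (z : Fin n × Fin n → ℂ) (r : Fin n) (hz : ∀ j, z (r, j) = 0)
    {a b c d : Fin n} (ha : a ≠ r) (hc : c ≠ r) :
    hess0 (transl z (perPoly (Fin n) ℂ)) (c, d) (a, b) = 0 := by
  classical
  rw [hess0_transl_perPoly]
  refine Finset.sum_eq_zero fun π _ => ?_
  by_cases hP : π b = a ∧ d ≠ b ∧ π d = c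
  · rw [if_pos hP]
    -- the factor at `i₀ = π⁻¹ r` is `z (r, i₀) = 0`
    have hi₀ : π.symm r ∈ (Finset.univ.erase b).erase d := by
      rw [Finset.mem_erase, Finset.mem_erase]
      refine ⟨fun h => hc ?_, fun h => ha ?_, Finset.mem_univ _⟩
      · rw [← hP.2.2, ← h, Equiv.apply_symm_apply]
      · rw [← hP.1, ← h, Equiv.apply_symm_apply]
    refine Finset.prod_eq_zero hi₀ ?_
    rw [Equiv.apply_symm_apply]
    exact hz _
  · rw [if_neg hP]

/-- ★★ **The König bound**: if a row of `z` vanishes then `rank Hess per_n (z) ≤ 2n` (the Hessian is supported on the `n` rows and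
the `n` columns indexed by the coordinates of that row).  Sharpness of PG(k < n): the subspace `{row r = 0}` has codimension `n`.
[folklore] -/
theorem rank_hess0_transl_perPoly_le_of_row_zero (z : Fin n × Fin n → ℂ) (r : Fin n) (hz : ∀ j, z (r, j) = 0) :
    (hess0 (transl z (perPoly (Fin n) ℂ))).rank ≤ 2 * n := by
  classical
  set H := hess0 (transl z (perPoly (Fin n) ℂ)) with hH
  set D : Matrix (Fin n × Fin n) (Fin n × Fin n) ℂ :=
    Matrix.diagonal (fun s => if s.1 = r then (1 : ℂ) else 0) with hD
  -- `H = D H + (1 − D) H D`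
  have hdec : H = D * H + (1 - D) * H * D := by
    ext ⟨c, d⟩ ⟨a, b⟩
    rw [Matrix.add_apply, Matrix.mul_diagonal, Matrix.sub_mul, Matrix.one_mul, Matrix.sub_apply,
      Matrix.diagonal_mul]
    dsimp only
    by_cases hc : c = r
    · rw [if_pos hc, one_mul, sub_self, zero_mul, add_zero]
    · rw [if_neg hc, zero_mul, zero_add, sub_zero]
      by_cases ha : a = r
      · rw [if_pos ha, mul_one]
      · rw [if_neg ha, mul_zero, hH, hess0_transl_perPoly_apply_eq_zero_of_row_zero z r hz ha hc]
  have hDrank : D.rank ≤ n := by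
    rw [hD, Matrix.rank_diagonal]
    -- the support of the diagonal is `{s | s.1 = r}`, in bijection with `Fin n`
    have hcard : Fintype.card {s : Fin n × Fin n // (if s.1 = r then (1 : ℂ) else 0) ≠ 0} = n := by
      rw [Fintype.card_eq.mpr ⟨Equiv.subtypeEquiv (Equiv.refl _) (fun s => by simp)|>.trans
        ((Equiv.subtypeEquivRight (fun s : Fin n × Fin n => (Iff.rfl : s.1 = r ↔ s.1 = r))).trans
        ⟨fun s => s.1.2, fun j => ⟨(r, j), rfl⟩, fun s => by
          obtain ⟨⟨c, d⟩, h⟩ := s; simp only at h; subst h; rfl, fun j => rfl⟩)⟩, Fintype.card_fin]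
    omega
  have hadd : ∀ A' B' : Matrix (Fin n × Fin n) (Fin n × Fin n) ℂ, (A' + B').rank ≤ A'.rank + B'.rank := by
    intro A' B'
    unfold Matrix.rank
    rw [Matrix.mulVecLin_add]
    calc Module.finrank ℂ (LinearMap.range (A'.mulVecLin + B'.mulVecLin))
        ≤ Module.finrank ℂ ↥(LinearMap.range A'.mulVecLin ⊔ LinearMap.range B'.mulVecLin) := by
          apply Submodule.finrank_mono
          rintro _ ⟨v, rfl⟩
          exact Submodule.add_mem_sup ⟨v, rfl⟩ ⟨v, rfl⟩
      _ ≤ _ := Submodule.finrank_add_le_finrank_add_finrank _ _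
  calc H.rank = (D * H + (1 - D) * H * D).rank := by rw [← hdec]
    _ ≤ (D * H).rank + ((1 - D) * H * D).rank := hadd _ _
    _ ≤ D.rank + D.rank := add_le_add (Matrix.rank_mul_le_left _ _) (Matrix.rank_mul_le_right _ _)
    _ ≤ 2 * n := by omega

end Koenig

end Summit.ValiantsHypothesis.ValiantsHypothesis.Theorems.GrenetZeonTwoDimCoefficients.ScalingClosure

end
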